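import Literature.Analysis.FluidPDE.LagrangianVelocityTimeDerivative
import Literature.Analysis.FluidPDE.BiotSavartCurlGradient
import Literature.Analysis.FluidPDE.LambFormCurlKernel
import HarnessLib

/-!
# The pressure of a particle-trajectory solution: the momentum equation
# `∂ₜv + (v·∇)v = −∇p`, `p = div Γ ∗ (v × ω) − ½|v|²`, with `p ∈ C¹` jointly in `(t, x)`
# (Majda–Bertozzi Prop. 2.23 "⇐" through Prop. 2.21)

Analysis/FluidPDE support file (everything proved; no definitions, no named facts) on the
discharge path of the named fact
`Literature.Analysis.FluidPDE.MajdaBertozzi2002_particleTrajectoryEuler`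
(`HolderEulerLagrangian.lean`; A. J. Majda, A. L. Bertozzi, *Vorticity and Incompressible Flow*,
CUP 2002, §2.5 **Prop. 2.23** with **Prop. 2.21**, p. 70–73 of the held text: "`v_t + v·∇v =
−∇p`" recovered from the vorticity–stream formulation). For a volume-preserving bijective
solution `X ∈ C¹([0, T); B)` of the particle-trajectory equations with `ω₀ ∈ C^γ`
(`0 < γ < 1`) compactly supported and weakly divergence free, and its Lagrangian velocity
`v(·, t) = K₃ ∗ ω(t)`:

* `IsParticleTrajectorySolution.momentum_eq` — **the momentum equation** on `[0, T) × ℝ³`: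
  `∂ₜv + (v·∇)v = −∇p` with the explicit pressure
  `p(x, t) = ∫ DΓ(x − y)(v × ω)(y, t) dy − ½|v(x, t)|²` (`= div Γ ∗ (v × ω) − ½|v|²`, the
  Bernoulli/Leray form): `∂ₜv = curl K₃ ∗ (v × ω)` (`LagrangianVelocityTimeDerivative.lean`),
  `curl K₃ ∗ h = h − ∇ div Γ ∗ h` (`BiotSavartCurlGradient.lean`), `curl v = ω` (the tree's
  `curl_lagrangianVelocity_eq_pushforwardVorticity`) and the Lamb form
  `(v·∇)v = ω × v + ∇(½|v|²)` (`LambFormCurlKernel.lean`);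
* `IsParticleTrajectorySolution.contDiffOn_pressure` — **`p` is `C¹` jointly in `(t, x)` on
  `[0, T) × ℝ³`**: `½|v|²` is (`LagrangianVelocityC1.lean`); the potential
  `q = div Γ ∗ (v × ω)` is read along trajectories, `q(X(α,t), t) = ∫ DΓ(X(α,t) − X(β,t))
  (v × ω)(X(β,t), t) dβ` (volume-preserving change of variables), where the density
  `(v × ω) ∘ X = F(X) × ∇_αX ω₀` is `C¹` in `t`, so `TrajectoryPotentialDerivative.lean`
  (`DΓ` is a `C¹` singular kernel) gives a jointly continuous time derivative within `[0, T)`;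
  the space derivative `∇q = v × ω − ∂ₜv` is jointly continuous; hence `q ∘ (flow)` is `C¹` and
  so is `q = (q ∘ flow) ∘ (inverse flow)` (`ParticleTrajectoryKinematics.lean`).

## Mathlib / tree search

No pressure construction for Lagrangian solutions in the tree (`lean search
'pressure.*lagrangian|lagrangianVelocity.*gradient'`). Used: the five preceding files of the path,
`curl_lagrangianVelocity_eq_pushforwardVorticity` (`PushforwardVorticityDivFree.lean`),
`convect_self_eq_cross_curl_add_gradient` (`LambFormCurlKernel.lean`), `cross_swap`,
`fderiv_eq_innerSL_gradient` (`BiotSavartNewtonKernel.lean`, `BiotSavartCurlPair.lean`), Mathlib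
`integral_image_eq_integral_abs_det_fderiv_smul`, `ContDiff.norm_sq`.

## References

* A. J. Majda, A. L. Bertozzi, *Vorticity and Incompressible Flow* (CUP 2002), §2.5 Prop. 2.21,
  Prop. 2.23 and their proofs (p. 70–73 of the held text), §1.8 (Leray form), §4.1 (4.4)–(4.5)
  (p. 123). [MajdaBertozziCUP2002]
-/

noncomputable section

open MeasureTheory Set Function Filter Metric InnerProductSpace
open _root_.Topology
open scoped NNReal RealInnerProductSpace

namespace Literature.Analysis.FluidPDE

open FunctionSpaces

/-! ### Volume-preserving change of variables and the transported vorticity -/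

/-- **Change of variables over a volume-preserving bijective member of `B`**:
`∫ g(Y β) dβ = ∫ g(y) dy` (`det ∇Y ≡ 1`; Majda–Bertozzi (2.114)/(4.37): "we use the change of
variables `X⁻¹(x) = α`"). [cite: MajdaBertozziCUP2002, §2.5 (2.114) (p. 71) and §4.1.3 (4.37) (p. 129)] -/
theorem integral_comp_volumePreserving {F' : Type*} [NormedAddCommGroup F'] [NormedSpace ℝ F']
    {γ : ℝ≥0} (Y : C1HolderMap (EuclideanSpace ℝ (Fin 3)) (EuclideanSpace ℝ (Fin 3)) γ)
    (hbij : Bijective (Y : EuclideanSpace ℝ (Fin 3) → EuclideanSpace ℝ (Fin 3)))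
    (hdet : ∀ a, (fderiv ℝ (Y : EuclideanSpace ℝ (Fin 3) → EuclideanSpace ℝ (Fin 3)) a).det = 1)
    (g : EuclideanSpace ℝ (Fin 3) → F') : ∫ a, g (Y a) = ∫ y, g y := by
  have hcv := integral_image_eq_integral_abs_det_fderiv_smul volume MeasurableSet.univ
    (fun a _ => (Y.differentiable a).hasFDerivAt.hasFDerivWithinAt) hbij.1.injOn g
  rw [image_univ_of_surjective hbij.2, Measure.restrict_univ] at hcv
  rw [hcv]
  refine integral_congr_ae (Eventually.of_forall fun a => ?_)
  simp only
  rw [hdet a, abs_one, one_smul]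

/-- For a volume-preserving map the transported vorticity is `∇Y ω₀ ∘ Y⁻¹` (no Jacobian
factor). [cite: MajdaBertozziCUP2002, §4.1 (4.5) (p. 123)] -/
theorem pushforwardVorticity_eq_fderiv_apply_invFun {ω₀ Y : EuclideanSpace ℝ (Fin 3) → EuclideanSpace ℝ (Fin 3)}
    (hdet : ∀ a, (fderiv ℝ Y a).det = 1) (x : EuclideanSpace ℝ (Fin 3)) :
    pushforwardVorticity ω₀ Y x = fderiv ℝ Y (Function.invFun Y x) (ω₀ (Function.invFun Y x)) := by
  rw [pushforwardVorticity, hdet, inv_one, one_smul]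

section Solution

variable {γ : ℝ≥0} (hγ : 0 < γ) (hγ1 : γ < 1) {T : ℝ}
  {ω₀ : EuclideanSpace ℝ (Fin 3) → EuclideanSpace ℝ (Fin 3)}
  {X : ℝ → C1HolderMap (EuclideanSpace ℝ (Fin 3)) (EuclideanSpace ℝ (Fin 3)) γ}
  (hω : MemHolder γ ω₀) (hωs : HasCompactSupport ω₀) (hX : IsParticleTrajectorySolution γ (Ico 0 T) ω₀ X)
include hγ hγ1 hω hωs hX

omit hωs in
/-- **The transported vorticity is jointly continuous on `[0, T) × ℝ³`** (`ω(x, t) =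
∇_αX ω₀(X⁻¹(x,t), t)`, joint continuity of `∇_αX ω₀` and of the inverse flow). [cite: MajdaBertozziCUP2002, §4.1 (4.5) (p. 123)] -/
theorem IsParticleTrajectorySolution.continuousOn_pushforwardVorticity :
    ContinuousOn (fun p : ℝ × EuclideanSpace ℝ (Fin 3) => pushforwardVorticity ω₀ (X p.1) p.2) (Ico 0 T ×ˢ univ) := by
  obtain ⟨C₀, hC₀⟩ := id hω
  have hωcont : Continuous ω₀ := hC₀.continuous hγ
  have hXc := hX.continuousOn
  have hdet := hX.volumePreserving
  have hΨ := continuousOn_invFun_curve hγ hγ1.le hXc hdet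
  have hW : ContinuousOn (fun p : ℝ × EuclideanSpace ℝ (Fin 3) =>
      fderiv ℝ (⇑(X p.1)) (Function.invFun (⇑(X p.1)) p.2) (ω₀ (Function.invFun (⇑(X p.1)) p.2))) (Ico 0 T ×ˢ univ) :=
    (C1HolderMap.continuousOn_fderiv_eval_curve_comp hXc hΨ).clm_apply (hωcont.comp_continuousOn hΨ)
  refine hW.congr fun p hp => ?_
  exact pushforwardVorticity_eq_fderiv_apply_invFun (hdet p.1 (mem_prod.1 hp).1) p.2

/-- **`h = v × ω` is jointly continuous on `[0, T) × ℝ³`.** [folklore] -/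
theorem IsParticleTrajectorySolution.continuousOn_cross :
    ContinuousOn (fun p : ℝ × EuclideanSpace ℝ (Fin 3) =>
      cross (lagrangianVelocity ω₀ (X p.1) p.2) (pushforwardVorticity ω₀ (X p.1) p.2)) (Ico 0 T ×ˢ univ) := by
  obtain ⟨C₀, hC₀⟩ := id hω
  have hωcont : Continuous ω₀ := hC₀.continuous hγ
  have hv : ContinuousOn (fun p : ℝ × EuclideanSpace ℝ (Fin 3) => lagrangianVelocity ω₀ (X p.1) p.2) (Ico 0 T ×ˢ univ) :=
    (hX.contDiffOn_lagrangianVelocity hγ hγ1.le hωcont hωs).continuousOn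
  have hw := hX.continuousOn_pushforwardVorticity hγ hγ1 hω
  exact (crossCLM.continuous.comp_continuousOn hv).clm_apply hw

/-- **`∇ div Γ ∗ (v × ω) = v × ω − ∂ₜv` on `[0, T) × ℝ³`** (`∂ₜv = curl K₃ ∗ (v × ω)` and
`curl K₃ ∗ h = h − ∇ div Γ ∗ h`); in particular the pressure gradient is jointly continuous. [cite: MajdaBertozziCUP2002, §2.5 proof of Prop. 2.23 with Prop. 2.21 (p. 70–73)] -/
theorem IsParticleTrajectorySolution.gradient_divPotential_eq (hdiv : IsWeaklyDivFree ω₀)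
    {t : ℝ} (ht : t ∈ Ico 0 T) (x : EuclideanSpace ℝ (Fin 3)) :
    gradient (fun x => ∫ y, fderiv ℝ newtonKernel (x - y)
        (cross (lagrangianVelocity ω₀ (X t) y) (pushforwardVorticity ω₀ (X t) y))) x =
      cross (lagrangianVelocity ω₀ (X t) x) (pushforwardVorticity ω₀ (X t) x) -
        timeDerivWithin (Ico 0 T) (fun s => lagrangianVelocity ω₀ (X s)) t x := by
  obtain ⟨Ch, Mh, hH, hhs, -, -, -⟩ := exists_cross_data hγ (X t) (hX.bijective t ht) (hX.volumePreserving t ht)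
    hω hωs hγ1.le
  have h1 := hX.timeDerivWithin_lagrangianVelocity_eq_curl_biotSavart_cross hγ hγ1.le hω hωs hdiv ht x
  have h2 := curl_biotSavart_eq_sub_gradient hH hγ hγ1 hhs x
  rw [h1, h2]
  abel

/-- **The pressure gradient is jointly continuous on `[0, T) × ℝ³`.** [folklore] -/
theorem IsParticleTrajectorySolution.continuousOn_gradient_divPotential (hdiv : IsWeaklyDivFree ω₀) :
    ContinuousOn (fun p : ℝ × EuclideanSpace ℝ (Fin 3) =>
      gradient (fun x => ∫ y, fderiv ℝ newtonKernel (x - y)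
        (cross (lagrangianVelocity ω₀ (X p.1) y) (pushforwardVorticity ω₀ (X p.1) y))) p.2) (Ico 0 T ×ˢ univ) := by
  obtain ⟨C₀, hC₀⟩ := id hω
  have hωcont : Continuous ω₀ := hC₀.continuous hγ
  have hv := hX.contDiffOn_lagrangianVelocity hγ hγ1.le hωcont hωs
  have hdt := continuousOn_timeDerivWithin_of_contDiffOn hv (uniqueDiffOn_Ico 0 T)
  have hcr := hX.continuousOn_cross hγ hγ1 hω hωs
  refine (hcr.sub hdt).congr fun p hp => ?_
  exact hX.gradient_divPotential_eq hγ hγ1 hω hωs hdiv (mem_prod.1 hp).1 p.2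

/-! ### The momentum equation -/

/-- **The momentum equation for the Lagrangian velocity of a particle-trajectory solution**
(Majda–Bertozzi Prop. 2.23 "⇐" through Prop. 2.21): with
`p(x, t) = ∫ DΓ(x − y)(v × ω)(y, t) dy − ½|v(x, t)|²`,

  `∂ₜv(x, t) + (v·∇)v(x, t) = −∇p(x, t)`   for all `t ∈ [0, T)`, `x ∈ ℝ³`

(`∂ₜv = curl K₃ ∗ (v × ω) = v × ω − ∇ div Γ ∗ (v × ω)`, `(v·∇)v = ω × v + ∇(½|v|²)` with
`curl v = ω`). [cite: MajdaBertozziCUP2002, §2.5 Prop. 2.21 and Prop. 2.23 (p. 70–73)] -/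
theorem IsParticleTrajectorySolution.momentum_eq (hdiv : IsWeaklyDivFree ω₀) {t : ℝ} (ht : t ∈ Ico 0 T)
    (x : EuclideanSpace ℝ (Fin 3)) :
    timeDerivWithin (Ico 0 T) (fun s => lagrangianVelocity ω₀ (X s)) t x +
      convect (lagrangianVelocity ω₀ (X t)) (lagrangianVelocity ω₀ (X t)) x =
      -gradient (fun x => (∫ y, fderiv ℝ newtonKernel (x - y)
          (cross (lagrangianVelocity ω₀ (X t) y) (pushforwardVorticity ω₀ (X t) y))) -
        ‖lagrangianVelocity ω₀ (X t) x‖ ^ 2 / 2) x := by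
  have hbij := hX.bijective t ht
  have hdet := hX.volumePreserving t ht
  obtain ⟨Ch, Mh, hH, hhs, -, -, -⟩ := exists_cross_data hγ (X t) hbij hdet hω hωs hγ1.le
  have hv1 : ContDiff ℝ 1 (lagrangianVelocity ω₀ (X t)) :=
    (exists_lagrangianVelocity_data hγ (X t) hbij hdet hω hωs hγ1.le).1
  have hvd : Differentiable ℝ (lagrangianVelocity ω₀ (X t)) := hv1.differentiable one_ne_zero
  -- `∂ₜv = h - ∇q`
  have h1 := hX.timeDerivWithin_lagrangianVelocity_eq_curl_biotSavart_cross hγ hγ1.le hω hωs hdiv ht x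
  have h2 := curl_biotSavart_eq_sub_gradient hH hγ hγ1 hhs x
  -- the Lamb form and `curl v = ω`
  have h3 := convect_self_eq_cross_curl_add_gradient (hvd x)
  have h4 : curl (lagrangianVelocity ω₀ (X t)) = pushforwardVorticity ω₀ (X t) :=
    curl_lagrangianVelocity_eq_pushforwardVorticity hγ (X t) hbij hdet hω hωs hdiv
  -- the gradient of the difference
  have hq : DifferentiableAt ℝ (fun x => ∫ y, fderiv ℝ newtonKernel (x - y)
      (cross (lagrangianVelocity ω₀ (X t) y) (pushforwardVorticity ω₀ (X t) y))) x :=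
    ((contDiff_integral_fderiv_newtonKernel_apply hH hγ hγ1 hhs).differentiable one_ne_zero) x
  have he : DifferentiableAt ℝ (fun x => ‖lagrangianVelocity ω₀ (X t) x‖ ^ 2 / 2) x :=
    ((hv1.norm_sq ℝ).div_const 2).differentiable one_ne_zero x
  have h5 : gradient (fun x => (∫ y, fderiv ℝ newtonKernel (x - y)
        (cross (lagrangianVelocity ω₀ (X t) y) (pushforwardVorticity ω₀ (X t) y))) -
        ‖lagrangianVelocity ω₀ (X t) x‖ ^ 2 / 2) x =
      gradient (fun x => ∫ y, fderiv ℝ newtonKernel (x - y)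
        (cross (lagrangianVelocity ω₀ (X t) y) (pushforwardVorticity ω₀ (X t) y))) x -
        gradient (fun x => ‖lagrangianVelocity ω₀ (X t) x‖ ^ 2 / 2) x := by
    unfold gradient
    rw [fderiv_fun_sub hq he, map_sub]
  rw [h1, h2, h3, h4, h5, cross_swap (pushforwardVorticity ω₀ (X t) x)]
  abel

/-! ### The potential `div Γ ∗ (v × ω)` read along trajectories, and its joint regularity -/

omit hγ hγ1 hω hωs in
/-- The Lagrangian density of `h = v × ω`: `h(X(β,t), t) = F(X(t))(β) × ∇_αX(β,t) ω₀(β)`. [cite: MajdaBertozziCUP2002, §4.1 (4.3)–(4.5) (p. 123)] -/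
theorem IsParticleTrajectorySolution.cross_apply_flow {t : ℝ} (ht : t ∈ Ico 0 T) (β : EuclideanSpace ℝ (Fin 3)) :
    cross (lagrangianVelocity ω₀ (X t) (X t β)) (pushforwardVorticity ω₀ (X t) (X t β)) =
      crossCLM (lagrangianField ω₀ (X t) β) (fderiv ℝ (⇑(X t)) β (ω₀ β)) := by
  rw [crossCLM_apply, pushforwardVorticity_apply_image_of_det_eq_one (hX.bijective t ht).1 (hX.volumePreserving t ht)]
  rfl

omit hγ hγ1 hω hωs in
/-- **The potential read along trajectories**: `q(X(α,t), t) = ∫ DΓ(X(α,t) − X(β,t))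
(F(X)(β) × ∇_αX ω₀(β)) dβ` (volume-preserving change of variables `y = X(β, t)`). [cite: MajdaBertozziCUP2002, §2.5 (2.114) (p. 71) and §4.1.3 (4.37) (p. 129)] -/
theorem IsParticleTrajectorySolution.divPotential_apply_flow {t : ℝ} (ht : t ∈ Ico 0 T) (a : EuclideanSpace ℝ (Fin 3)) :
    (∫ y, fderiv ℝ newtonKernel (X t a - y) (cross (lagrangianVelocity ω₀ (X t) y) (pushforwardVorticity ω₀ (X t) y))) =
      ∫ β, fderiv ℝ newtonKernel (X t a - X t β) (crossCLM (lagrangianField ω₀ (X t) β) (fderiv ℝ (⇑(X t)) β (ω₀ β))) := by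
  rw [← integral_comp_volumePreserving (X t) (hX.bijective t ht) (hX.volumePreserving t ht)]
  refine integral_congr_ae (Eventually.of_forall fun β => ?_)
  simp only
  rw [hX.cross_apply_flow ht β]

/-- **The Lagrangian density `F(X) × ∇_αX ω₀` of `h = v × ω` and its time derivative**: jointly
continuous on `[0, T) × ℝ³`, differentiable in `t` within `[0, T)` with derivative
`∂ₜF(X) × ∇_αX ω₀ + F(X) × ∇_αF(X) ω₀`, both supported in a fixed ball (that of `supp ω₀`). [cite: MajdaBertozziCUP2002, §4.1 (4.3)–(4.5) (p. 123) and §4.2 (4.45) (p. 133)] -/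
theorem IsParticleTrajectorySolution.crossDensity_data :
    ∃ R : ℝ,
      ContinuousOn (fun p : ℝ × EuclideanSpace ℝ (Fin 3) =>
        crossCLM (lagrangianField ω₀ (X p.1) p.2) (fderiv ℝ (⇑(X p.1)) p.2 (ω₀ p.2))) (Ico 0 T ×ˢ univ) ∧
      ContinuousOn (fun p : ℝ × EuclideanSpace ℝ (Fin 3) =>
        crossCLM (timeDerivWithin (Ico 0 T) (fun s => lagrangianField ω₀ (X s)) p.1 p.2) (fderiv ℝ (⇑(X p.1)) p.2 (ω₀ p.2)) +
          crossCLM (lagrangianField ω₀ (X p.1) p.2) (fderiv ℝ (lagrangianField ω₀ (X p.1)) p.2 (ω₀ p.2))) (Ico 0 T ×ˢ univ) ∧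
      (∀ t ∈ Ico 0 T, ∀ β, HasDerivWithinAt
        (fun s => crossCLM (lagrangianField ω₀ (X s) β) (fderiv ℝ (⇑(X s)) β (ω₀ β)))
        (crossCLM (timeDerivWithin (Ico 0 T) (fun s => lagrangianField ω₀ (X s)) t β) (fderiv ℝ (⇑(X t)) β (ω₀ β)) +
          crossCLM (lagrangianField ω₀ (X t) β) (fderiv ℝ (lagrangianField ω₀ (X t)) β (ω₀ β))) (Ico 0 T) t) ∧
      (∀ t ∈ Ico 0 T, support (fun β => crossCLM (lagrangianField ω₀ (X t) β) (fderiv ℝ (⇑(X t)) β (ω₀ β))) ⊆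
        closedBall 0 R) ∧
      (∀ t ∈ Ico 0 T, support (fun β =>
        crossCLM (timeDerivWithin (Ico 0 T) (fun s => lagrangianField ω₀ (X s)) t β) (fderiv ℝ (⇑(X t)) β (ω₀ β)) +
          crossCLM (lagrangianField ω₀ (X t) β) (fderiv ℝ (lagrangianField ω₀ (X t)) β (ω₀ β))) ⊆ closedBall 0 R) := by
  obtain ⟨C₀, hC₀⟩ := id hω
  have hωcont : Continuous ω₀ := hC₀.continuous hγ
  have hXc : ContinuousOn X (Ico 0 T) := hX.continuousOn
  have hΛ := hX.contDiffOn_lagrangianField hγ hγ1.le hωcont hωs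
  have hΛc := hΛ.continuousOn
  have hdtΛ := continuousOn_timeDerivWithin_of_contDiffOn (w := fun s => lagrangianField ω₀ (X s)) hΛ (uniqueDiffOn_Ico 0 T)
  have hDΛ : ContinuousOn (fun p : ℝ × EuclideanSpace ℝ (Fin 3) => fderiv ℝ (lagrangianField ω₀ (X p.1)) p.2 (ω₀ p.2))
      (Ico 0 T ×ˢ univ) :=
    (continuousOn_fderiv_slice_of_contDiffOn (w := fun s => lagrangianField ω₀ (X s)) hΛ (uniqueDiffOn_Ico 0 T)).clm_apply
      (hωcont.comp continuous_snd).continuousOn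
  have hW := continuousOn_fderiv_apply_vorticity hXc hωcont
  obtain ⟨R, hR⟩ := hωs.isCompact.isBounded.subset_closedBall (0 : EuclideanSpace ℝ (Fin 3))
  refine ⟨R, (crossCLM.continuous.comp_continuousOn hΛc).clm_apply hW,
    ((crossCLM.continuous.comp_continuousOn hdtΛ).clm_apply hW).add
      ((crossCLM.continuous.comp_continuousOn hΛc).clm_apply hDΛ), fun t ht β => ?_, fun t _ => ?_, fun t _ => ?_⟩
  · have hc : HasDerivWithinAt (fun s => crossCLM (lagrangianField ω₀ (X s) β))
        (crossCLM (timeDerivWithin (Ico 0 T) (fun s => lagrangianField ω₀ (X s)) t β)) (Ico 0 T) t :=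
      crossCLM.hasFDerivAt.comp_hasDerivWithinAt t
        (hasDerivWithinAt_timeLine_of_contDiffOn (w := fun s => lagrangianField ω₀ (X s)) hΛ (uniqueDiffOn_Ico 0 T) ht β)
    exact hc.clm_apply (hX.hasDerivWithinAt_fderiv_apply_lagrangianField ht β (ω₀ β))
  · intro β hβ
    refine hR (subset_tsupport _ ?_)
    rw [mem_support] at hβ ⊢
    intro h0; exact hβ (by rw [h0, map_zero, map_zero])
  · intro β hβ
    refine hR (subset_tsupport _ ?_)
    rw [mem_support] at hβ ⊢
    intro h0
    exact hβ (by rw [h0, map_zero, map_zero, map_zero, map_zero, add_zero])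

/-- **The potential read along trajectories is differentiable in `t` within `[0, T)`** (`DΓ` is
a `C¹` singular kernel, the density `F(X) × ∇_αX ω₀` is `C¹` in `t`;
`TrajectoryPotentialDerivative.lean`). Stated with an explicit derivative curve `X'`. [cite: MajdaBertozziCUP2002, §4.1.3 proof of Prop. 4.2 (p. 130)] -/
theorem IsParticleTrajectorySolution.hasDerivWithinAt_divPotential_flow
    {X' : ℝ → C1HolderMap (EuclideanSpace ℝ (Fin 3)) (EuclideanSpace ℝ (Fin 3)) γ}
    (hd : ∀ t ∈ Ico 0 T, HasDerivWithinAt X (X' t) (Ico 0 T) t) (hX'c : ContinuousOn X' (Ico 0 T))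
    {t₀ : ℝ} (ht₀ : t₀ ∈ Ico 0 T) (a : EuclideanSpace ℝ (Fin 3)) :
    HasDerivWithinAt (fun t => ∫ β, fderiv ℝ newtonKernel (X t a - X t β)
        (crossCLM (lagrangianField ω₀ (X t) β) (fderiv ℝ (⇑(X t)) β (ω₀ β))))
      (∫ β, ((fderiv ℝ (fun z => fderiv ℝ newtonKernel z) (X t₀ a - X t₀ β) (X' t₀ a - X' t₀ β))
          (crossCLM (lagrangianField ω₀ (X t₀) β) (fderiv ℝ (⇑(X t₀)) β (ω₀ β))) +
        fderiv ℝ newtonKernel (X t₀ a - X t₀ β)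
          (crossCLM (timeDerivWithin (Ico 0 T) (fun s => lagrangianField ω₀ (X s)) t₀ β) (fderiv ℝ (⇑(X t₀)) β (ω₀ β)) +
            crossCLM (lagrangianField ω₀ (X t₀) β) (fderiv ℝ (lagrangianField ω₀ (X t₀)) β (ω₀ β))))) (Ico 0 T) t₀ := by
  obtain ⟨A, hK⟩ := exists_isC1SingularKernel_fderiv_newtonKernel
  obtain ⟨R, hmj, hm'j, hmd, hms, hm's⟩ := hX.crossDensity_data hγ hγ1 hω hωs
  exact hasDerivWithinAt_integral_kernel_curve_Ico hγ hγ1.le hK hd hX'c hX.volumePreserving hmj hm'j hmd hms hm's ht₀ a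

/-- **The time derivative of the potential along trajectories is jointly continuous on
`[0, T) × ℝ³`.** [cite: MajdaBertozziCUP2002, §4.1.3 proof of Prop. 4.2 (p. 130)] -/
theorem IsParticleTrajectorySolution.continuousOn_divPotentialDeriv_flow
    {X' : ℝ → C1HolderMap (EuclideanSpace ℝ (Fin 3)) (EuclideanSpace ℝ (Fin 3)) γ}
    (hd : ∀ t ∈ Ico 0 T, HasDerivWithinAt X (X' t) (Ico 0 T) t) (hX'c : ContinuousOn X' (Ico 0 T)) :
    ContinuousOn (fun p : ℝ × EuclideanSpace ℝ (Fin 3) =>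
      ∫ β, ((fderiv ℝ (fun z => fderiv ℝ newtonKernel z) (X p.1 p.2 - X p.1 β) (X' p.1 p.2 - X' p.1 β))
          (crossCLM (lagrangianField ω₀ (X p.1) β) (fderiv ℝ (⇑(X p.1)) β (ω₀ β))) +
        fderiv ℝ newtonKernel (X p.1 p.2 - X p.1 β)
          (crossCLM (timeDerivWithin (Ico 0 T) (fun s => lagrangianField ω₀ (X s)) p.1 β) (fderiv ℝ (⇑(X p.1)) β (ω₀ β)) +
            crossCLM (lagrangianField ω₀ (X p.1) β) (fderiv ℝ (lagrangianField ω₀ (X p.1)) β (ω₀ β))))) (Ico 0 T ×ˢ univ) := by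
  obtain ⟨A, hK⟩ := exists_isC1SingularKernel_fderiv_newtonKernel
  obtain ⟨R, hmj, hm'j, -, hms, hm's⟩ := hX.crossDensity_data hγ hγ1 hω hωs
  exact continuousOn_integral_kernelDeriv_curve_Ico hγ hγ1.le hK hd hX'c hX.volumePreserving hmj hm'j hms hm's

/-- **The potential `q = div Γ ∗ (v × ω)` read along trajectories is `C¹` on `[0, T) × ℝ³`**:
time partial within `[0, T)` by the previous lemmas, space partial `∇q(X(α,t),t) ∇_αX(α,t)`
with `∇q = v × ω − ∂ₜv` jointly continuous. [cite: MajdaBertozziCUP2002, §2.5 Prop. 2.21 and Prop. 2.23 (p. 70–73)] -/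
theorem IsParticleTrajectorySolution.contDiffOn_divPotential_flow (hdiv : IsWeaklyDivFree ω₀) :
    ContDiffOn ℝ 1 (fun p : ℝ × EuclideanSpace ℝ (Fin 3) =>
      ∫ y, fderiv ℝ newtonKernel (X p.1 p.2 - y)
        (cross (lagrangianVelocity ω₀ (X p.1) y) (pushforwardVorticity ω₀ (X p.1) y))) (Ico 0 T ×ˢ univ) := by
  obtain ⟨X', hX'c, hd, -⟩ := hX.hasDeriv
  have hXc : ContinuousOn X (Ico 0 T) := hX.continuousOn
  -- work with the Lagrangian representation
  have hrep : ∀ p ∈ Ico 0 T ×ˢ (univ : Set (EuclideanSpace ℝ (Fin 3))),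
      (∫ β, fderiv ℝ newtonKernel (X p.1 p.2 - X p.1 β)
        (crossCLM (lagrangianField ω₀ (X p.1) β) (fderiv ℝ (⇑(X p.1)) β (ω₀ β)))) =
      ∫ y, fderiv ℝ newtonKernel (X p.1 p.2 - y)
        (cross (lagrangianVelocity ω₀ (X p.1) y) (pushforwardVorticity ω₀ (X p.1) y)) :=
    fun p hp => (hX.divPotential_apply_flow (mem_prod.1 hp).1 p.2).symm
  refine ContDiffOn.congr ?_ fun p hp => (hrep p hp).symm
  -- the gradient field `∇q(t, y)` is jointly continuous
  have hG := hX.continuousOn_gradient_divPotential hγ hγ1 hω hωs hdiv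
  have hflow : ContinuousOn (fun p : ℝ × EuclideanSpace ℝ (Fin 3) => X p.1 p.2) (Ico 0 T ×ˢ univ) :=
    C1HolderMap.continuousOn_eval_curve hXc
  have hGX : ContinuousOn (fun p : ℝ × EuclideanSpace ℝ (Fin 3) =>
      gradient (fun x => ∫ y, fderiv ℝ newtonKernel (x - y)
        (cross (lagrangianVelocity ω₀ (X p.1) y) (pushforwardVorticity ω₀ (X p.1) y))) (X p.1 p.2)) (Ico 0 T ×ˢ univ) :=
    hG.comp (continuousOn_fst.prodMk hflow) fun p hp => mem_prod.2 ⟨(mem_prod.1 hp).1, mem_univ _⟩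
  -- space partials
  have hq1 : ∀ t ∈ Ico 0 T, ContDiff ℝ 1 (fun x => ∫ y, fderiv ℝ newtonKernel (x - y)
      (cross (lagrangianVelocity ω₀ (X t) y) (pushforwardVorticity ω₀ (X t) y))) := by
    intro t ht
    obtain ⟨Ch, Mh, hH, hhs, -, -, -⟩ := exists_cross_data hγ (X t) (hX.bijective t ht) (hX.volumePreserving t ht)
      hω hωs hγ1.le
    exact contDiff_integral_fderiv_newtonKernel_apply hH hγ hγ1 hhs
  have h₂ : ∀ p ∈ Ico 0 T ×ˢ (univ : Set (EuclideanSpace ℝ (Fin 3))), HasFDerivAt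
      (fun b => ∫ β, fderiv ℝ newtonKernel (X p.1 b - X p.1 β)
        (crossCLM (lagrangianField ω₀ (X p.1) β) (fderiv ℝ (⇑(X p.1)) β (ω₀ β))))
      ((innerSL ℝ (gradient (fun x => ∫ y, fderiv ℝ newtonKernel (x - y)
        (cross (lagrangianVelocity ω₀ (X p.1) y) (pushforwardVorticity ω₀ (X p.1) y))) (X p.1 p.2))).comp
        (fderiv ℝ (⇑(X p.1)) p.2)) p.2 := by
    intro p hp
    have ht : p.1 ∈ Ico 0 T := (mem_prod.1 hp).1
    have e : (fun b => ∫ β, fderiv ℝ newtonKernel (X p.1 b - X p.1 β)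
        (crossCLM (lagrangianField ω₀ (X p.1) β) (fderiv ℝ (⇑(X p.1)) β (ω₀ β)))) =
        (fun x => ∫ y, fderiv ℝ newtonKernel (x - y)
          (cross (lagrangianVelocity ω₀ (X p.1) y) (pushforwardVorticity ω₀ (X p.1) y))) ∘ ⇑(X p.1) := by
      funext b
      exact (hX.divPotential_apply_flow ht b).symm
    rw [e]
    have hq := ((hq1 p.1 ht).differentiable one_ne_zero (X p.1 p.2)).hasFDerivAt
    rw [fderiv_eq_innerSL_gradient] at hq
    exact hq.comp p.2 ((X p.1).differentiable p.2).hasFDerivAt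
  have hc₂ : ContinuousOn (fun p : ℝ × EuclideanSpace ℝ (Fin 3) =>
      (innerSL ℝ (gradient (fun x => ∫ y, fderiv ℝ newtonKernel (x - y)
        (cross (lagrangianVelocity ω₀ (X p.1) y) (pushforwardVorticity ω₀ (X p.1) y))) (X p.1 p.2))).comp
        (fderiv ℝ (⇑(X p.1)) p.2)) (Ico 0 T ×ˢ univ) :=
    ((innerSL ℝ).continuous.comp_continuousOn hGX).clm_comp (C1HolderMap.continuousOn_fderiv_eval_curve hXc)
  -- time partials and assembly
  have hDc := hX.continuousOn_divPotentialDeriv_flow hγ hγ1 hω hωs hd hX'c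
  have h := Calculus.contDiffOn_succ_of_partial_within
    (f := fun p : ℝ × EuclideanSpace ℝ (Fin 3) => ∫ β, fderiv ℝ newtonKernel (X p.1 p.2 - X p.1 β)
        (crossCLM (lagrangianField ω₀ (X p.1) β) (fderiv ℝ (⇑(X p.1)) β (ω₀ β))))
    (convex_Ico 0 T) (uniqueDiffOn_Ico 0 T) (n := 0)
    (f₁ := fun p => (1 : ℝ →L[ℝ] ℝ).smulRight
      (∫ β, ((fderiv ℝ (fun z => fderiv ℝ newtonKernel z) (X p.1 p.2 - X p.1 β) (X' p.1 p.2 - X' p.1 β))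
          (crossCLM (lagrangianField ω₀ (X p.1) β) (fderiv ℝ (⇑(X p.1)) β (ω₀ β))) +
        fderiv ℝ newtonKernel (X p.1 p.2 - X p.1 β)
          (crossCLM (timeDerivWithin (Ico 0 T) (fun s => lagrangianField ω₀ (X s)) p.1 β) (fderiv ℝ (⇑(X p.1)) β (ω₀ β)) +
            crossCLM (lagrangianField ω₀ (X p.1) β) (fderiv ℝ (lagrangianField ω₀ (X p.1)) β (ω₀ β))))))
    (f₂ := fun p => (innerSL ℝ (gradient (fun x => ∫ y, fderiv ℝ newtonKernel (x - y)
        (cross (lagrangianVelocity ω₀ (X p.1) y) (pushforwardVorticity ω₀ (X p.1) y))) (X p.1 p.2))).comp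
        (fderiv ℝ (⇑(X p.1)) p.2))
    (fun p hp => (hX.hasDerivWithinAt_divPotential_flow hγ hγ1 hω hωs hd hX'c (mem_prod.1 hp).1 p.2).hasFDerivWithinAt)
    h₂ (contDiffOn_zero.2 (C1HolderMap.continuousOn_smulRight_one hDc)) (contDiffOn_zero.2 hc₂)
  simpa using h

/-- **The potential `q(x, t) = ∫ DΓ(x − y)(v × ω)(y, t) dy` is `C¹` jointly on `[0, T) × ℝ³`**
(`q = (q ∘ flow) ∘ (inverse flow)` with both factors `C¹`). [cite: MajdaBertozziCUP2002, §2.5 Prop. 2.21 and Prop. 2.23 (p. 70–73)] -/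
theorem IsParticleTrajectorySolution.contDiffOn_divPotential (hdiv : IsWeaklyDivFree ω₀) :
    ContDiffOn ℝ 1 (fun p : ℝ × EuclideanSpace ℝ (Fin 3) =>
      ∫ y, fderiv ℝ newtonKernel (p.2 - y)
        (cross (lagrangianVelocity ω₀ (X p.1) y) (pushforwardVorticity ω₀ (X p.1) y))) (Ico 0 T ×ˢ univ) := by
  obtain ⟨C₀, hC₀⟩ := id hω
  have hωcont : Continuous ω₀ := hC₀.continuous hγ
  have hR := hX.contDiffOn_divPotential_flow hγ hγ1 hω hωs hdiv
  have hΨ := hX.contDiffOn_invFun hγ hγ1.le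
  have h := contDiffOn_comp_invFun_curve
    (Λ := fun p : ℝ × EuclideanSpace ℝ (Fin 3) => ∫ y, fderiv ℝ newtonKernel (X p.1 p.2 - y)
      (cross (lagrangianVelocity ω₀ (X p.1) y) (pushforwardVorticity ω₀ (X p.1) y))) hR hΨ
  refine h.congr fun p hp => ?_
  simp only
  rw [apply_invFun_curve hγ hγ1.le hX.volumePreserving (mem_prod.1 hp).1]

/-- **The pressure `p = div Γ ∗ (v × ω) − ½|v|²` is `C¹` jointly on `[0, T) × ℝ³`** — the
space–time regularity clause of the solution class for the pressure of Prop. 2.23. [cite: MajdaBertozziCUP2002, §2.5 Prop. 2.21 and Prop. 2.23 (p. 70–73)] -/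
theorem IsParticleTrajectorySolution.contDiffOn_pressure (hdiv : IsWeaklyDivFree ω₀) :
    ContDiffOn ℝ 1 (uncurry fun t x => (∫ y, fderiv ℝ newtonKernel (x - y)
        (cross (lagrangianVelocity ω₀ (X t) y) (pushforwardVorticity ω₀ (X t) y))) -
        ‖lagrangianVelocity ω₀ (X t) x‖ ^ 2 / 2) (Ico 0 T ×ˢ univ) := by
  obtain ⟨C₀, hC₀⟩ := id hω
  have hωcont : Continuous ω₀ := hC₀.continuous hγ
  have hv := hX.contDiffOn_lagrangianVelocity hγ hγ1.le hωcont hωs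
  have hq := hX.contDiffOn_divPotential hγ hγ1 hω hωs hdiv
  exact hq.sub ((hv.norm_sq ℝ).div_const 2)

end Solution

end Literature.Analysis.FluidPDE
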